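import Summits.QuantumAdvantage.QuantumAdvantage.Theorems.CharDialPlaneDivAscentD1
import HarnessLib

/-!
# PlaneDivAscent — PART D2: hyperplane ascent, dimension elimination, transport (continuation of D1)
(cell decomp-qadv, lens 6, g21 REV2; tree-ready, Prop-definition-free; see D1's module docstring for the plan.)
★ `exists_period_of_hyper` (slab period spaces of dim ≥ 1 on all hyperplanes + the hyperplane lemma ⇒ a period),
★★ `law_iff_succ K` (codimension law `K` ⟺ rigidity in dimension `K + 1`), the transport to the model space
`𝔽_p^{K+1}` and ★★ `law_iff_top K`.
-/

set_option autoImplicit false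

namespace Summit.QuantumAdvantage.AdviceFreeQNC0.PlaneDiv

open Finset Module

variable {p : ℕ} [Fact p.Prime] {n : ℕ}


/-! ## The hyperplane ascent -/

/-- ★ HYPERPLANE ASCENT.  If `S ⊆ W` is plane-divisible, `dim W ≥ K + 2` and the codimension bound `K`
holds in all smaller dimensions, then `S` has a nonzero period in `W`.  (Slab periods on all affine
hyperplanes `{β = 1}` + double counting + the hyperplane lemma `HL.hl_abstract`.) -/
theorem exists_period_of_hyper {W : Submodule (ZMod p) (Fin n → ZMod p)}
    {S : Finset (Fin n → ZMod p)} {K : ℕ} (hSW : ∀ x ∈ S, x ∈ W)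
    (hdiv : ∀ x ∈ W, ∀ a ∈ W, ∀ b ∈ W, p ∣ planeCount S x a b) (hdim : K + 2 ≤ finrank (ZMod p) W)
    (ih : ∀ (W' : Submodule (ZMod p) (Fin n → ZMod p)) (S' : Finset (Fin n → ZMod p)),
      finrank (ZMod p) W' < finrank (ZMod p) W → (∀ x ∈ S', x ∈ W') →
      (∀ x ∈ W', ∀ a ∈ W', ∀ b ∈ W', p ∣ planeCount S' x a b) →
      finrank (ZMod p) W' ≤ finrank (ZMod p) (perIn W' S') + K) :
    ∃ d ∈ perIn W S, d ≠ 0 := by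
  classical
  set m := finrank (ZMod p) W with hm
  -- nonzero coefficient vectors
  set B : Finset (Fin m → ZMod p) := Finset.univ.erase 0 with hB
  have hBmem : ∀ β ∈ B, β ≠ 0 := fun β hβ => Finset.ne_of_mem_erase hβ
  have hp2 : 2 ≤ p := (Fact.out : p.Prime).two_le
  -- slab period spaces are at least one-dimensional
  have hrank : ∀ β ∈ B, 1 ≤ finrank (ZMod p) (slabPer W S β) := by
    intro β hβ
    have h1 := finrank_kerSub W (hBmem β hβ)
    have h2 : finrank (ZMod p) (kerSub W β) ≤
        finrank (ZMod p) (perIn (kerSub W β) (slab W S β)) + K :=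
      ih _ _ (by omega) (slab_subset W S β) (dvd_planeCount_slab hdiv β)
    unfold slabPer
    omega
  -- the finsets of nonzero slab periods
  set PF : (Fin m → ZMod p) → Finset (Fin n → ZMod p) := fun β =>
    (Finset.univ.filter fun d => d ∈ slabPer W S β).erase 0 with hPF
  have hPFmem : ∀ β d, d ∈ PF β ↔ d ≠ 0 ∧ d ∈ slabPer W S β := by
    intro β d
    simp only [hPF, Finset.mem_erase, Finset.mem_filter, Finset.mem_univ, true_and]
  have hcardP : ∀ β ∈ B, p - 1 ≤ (PF β).card := by
    intro β hβ
    have hfull : (Finset.univ.filter fun d => d ∈ slabPer W S β).card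
        = p ^ finrank (ZMod p) (slabPer W S β) := by
      have hc := Module.card_eq_pow_finrank (K := ZMod p) (V := slabPer W S β)
      rw [ZMod.card] at hc
      rw [← hc]
      exact (Fintype.card_subtype _).symm
    have hge : p ≤ (Finset.univ.filter fun d => d ∈ slabPer W S β).card := by
      rw [hfull]
      calc p = p ^ 1 := (pow_one p).symm
        _ ≤ p ^ finrank (ZMod p) (slabPer W S β) := Nat.pow_le_pow_right (by omega) (hrank β hβ)
    have h0 : (0 : Fin n → ZMod p) ∈ (Finset.univ.filter fun d => d ∈ slabPer W S β) := by
      simp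
    have := Finset.card_erase_of_mem h0
    simp only [hPF]
    omega
  -- double counting
  set N : (Fin n → ZMod p) → ℕ := fun d => (B.filter fun β => d ∈ PF β).card with hN
  have hcount : ∑ β ∈ B, (PF β).card = ∑ d, N d := by
    have h1 : ∀ β ∈ B, (PF β).card = ∑ d, if d ∈ PF β then 1 else 0 := by
      intro β _
      rw [Finset.sum_boole, Finset.filter_univ_mem]
      simp
    rw [Finset.sum_congr rfl h1, Finset.sum_comm]
    refine Finset.sum_congr rfl fun d _ => ?_
    rw [hN, Finset.sum_boole]
    simp
  have hNW : ∀ d, N d ≠ 0 → d ∈ W ∧ d ≠ 0 := by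
    intro d hd
    obtain ⟨β, hβ⟩ := Finset.card_pos.mp (Nat.pos_of_ne_zero hd)
    rw [Finset.mem_filter] at hβ
    obtain ⟨hd0, hdP⟩ := (hPFmem β d).mp hβ.2
    exact ⟨slabPer_le W S β hdP, hd0⟩
  -- cardinalities
  have hcardB : B.card = p ^ m - 1 := by
    rw [hB, Finset.card_erase_of_mem (Finset.mem_univ _), Finset.card_univ, Fintype.card_fun,
      ZMod.card, Fintype.card_fin]
  have hcardW : ((Finset.univ.filter fun d : Fin n → ZMod p => d ∈ W).erase 0).card = p ^ m - 1 := by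
    have hfull : (Finset.univ.filter fun d : Fin n → ZMod p => d ∈ W).card = p ^ m := by
      have hc := Module.card_eq_pow_finrank (K := ZMod p) (V := W)
      rw [ZMod.card] at hc
      rw [hm, ← hc]
      exact (Fintype.card_subtype _).symm
    have h0 : (0 : Fin n → ZMod p) ∈ (Finset.univ.filter fun d : Fin n → ZMod p => d ∈ W) := by simp
    rw [Finset.card_erase_of_mem h0, hfull]
  have hpm : 1 ≤ p ^ m := Nat.one_le_pow _ _ (by omega)
  -- some `d` is a slab period for at least `p - 1` coefficient vectors
  obtain ⟨d, hd⟩ : ∃ d, p - 1 ≤ N d := by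
    by_contra hcon
    simp only [not_exists, not_le] at hcon
    have hle : ∑ d, N d ≤ ∑ d : Fin n → ZMod p, (if d ∈ W ∧ d ≠ 0 then p - 2 else 0) := by
      apply Finset.sum_le_sum
      intro d _
      by_cases hNd : N d = 0
      · rw [hNd]; exact Nat.zero_le _
      · rw [if_pos (hNW d hNd)]
        have := hcon d
        omega
    have hsum : ∑ d : Fin n → ZMod p, (if d ∈ W ∧ d ≠ 0 then p - 2 else 0)
        = ((Finset.univ.filter fun d : Fin n → ZMod p => d ∈ W).erase 0).card * (p - 2) := by
      rw [← Finset.sum_filter, Finset.sum_const, smul_eq_mul]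
      congr 2
      ext d
      simp [Finset.mem_erase, and_comm]
    have hlow : B.card * (p - 1) ≤ ∑ β ∈ B, (PF β).card := by
      have := Finset.card_nsmul_le_sum B (fun β => (PF β).card) (p - 1) hcardP
      simpa using this
    rw [hcount] at hlow
    rw [hsum, hcardW] at hle
    rw [hcardB] at hlow
    have : (p ^ m - 1) * (p - 1) ≤ (p ^ m - 1) * (p - 2) := le_trans hlow hle
    have h3 : (p ^ m - 1) * (p - 2) < (p ^ m - 1) * (p - 1) :=
      Nat.mul_lt_mul_of_pos_left (by omega) (by
        have h1 : p ^ 2 ≤ p ^ m := Nat.pow_le_pow_right (by omega) (by omega)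
        have h2 : 2 ^ 2 ≤ p ^ 2 := Nat.pow_le_pow_left hp2 2
        omega)
    omega
  have hdW : d ∈ W ∧ d ≠ 0 := hNW d (by omega)
  -- choose `p - 1` of them
  obtain ⟨t, htsub, htcard⟩ := Finset.exists_subset_card_eq hd
  have htmem : ∀ β ∈ t, β ≠ 0 ∧ d ∈ slabPer W S β := by
    intro β hβ
    have := htsub hβ
    rw [Finset.mem_filter] at this
    exact ⟨hBmem β this.1, ((hPFmem β d).mp this.2).2⟩
  have hct : Fintype.card t = p - 1 := by rw [Fintype.card_coe]; exact htcard
  set e : t ≃ Fin (p - 1) := Fintype.equivFinOfCardEq hct with he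
  set φ : Fin (p - 1) → (W →ₗ[ZMod p] ZMod p) := fun i => cfun W (e.symm i).1 with hφ
  -- the function `F_d` on `W`
  set g : W → ZMod p := fun w => (lineCount S d (w : Fin n → ZMod p) : ZMod p) with hg
  have hlines : ∀ y v : W, ∑ t : ZMod p, g (y + t • v) = 0 := by
    intro y v
    simp only [hg, Submodule.coe_add, Submodule.coe_smul]
    rw [← Nat.cast_sum, sum_lineCount_eq_planeCount, ZMod.natCast_eq_zero_iff]
    exact hdiv _ y.2 _ v.2 d hdW.1
  have hφ0 : ∀ i, φ i ≠ 0 := fun i => cfun_ne_zero W (htmem _ (e.symm i).2).1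
  have hprop : ∀ i j, i ≠ j → ∀ l : ZMod p, ¬ (φ j = l • φ i ∧ (1 : ZMod p) = l * 1) := by
    intro i j hij l hl
    obtain ⟨h1, h2⟩ := hl
    rw [mul_one] at h2
    rw [← h2, one_smul] at h1
    have hb : (e.symm j).1 = (e.symm i).1 := cfun_injective W h1
    have : e.symm j = e.symm i := Subtype.ext hb
    exact hij (e.symm.injective this).symm
  have hvan : ∀ i, ∀ x : W, φ i x = 1 → g x = 0 := by
    intro i x hx
    simp only [hg]
    rw [ZMod.natCast_eq_zero_iff]
    exact dvd_lineCount_of_mem_slabPer (htmem _ (e.symm i).2).1 (htmem _ (e.symm i).2).2 x hx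
  have hzero : ∀ x : W, g x = 0 :=
    HL.hl_abstract W g hlines φ (fun _ => 1) hφ0 hprop hvan
  refine ⟨d, mem_perIn.mpr ⟨hdW.1, ?_⟩, hdW.2⟩
  exact isPeriod_of_lineCount_cast hSW hdW.1 fun y hy => hzero ⟨y, hy⟩

/-! ## Dimension elimination -/

/-- ★ DIMENSION ELIMINATION (one `p`, one ambient `n`, one `K`): the codimension law `K` for all subspaces
is equivalent to «every plane-divisible set in a `(K+1)`-dimensional subspace has a nonzero period». -/
theorem law_iff_succ (K : ℕ) :
    (∀ (W : Submodule (ZMod p) (Fin n → ZMod p)) (S : Finset (Fin n → ZMod p)),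
        (∀ x ∈ S, x ∈ W) → (∀ x ∈ W, ∀ a ∈ W, ∀ b ∈ W, p ∣ planeCount S x a b) →
        finrank (ZMod p) W ≤ finrank (ZMod p) (perIn W S) + K) ↔
    (∀ (W : Submodule (ZMod p) (Fin n → ZMod p)) (S : Finset (Fin n → ZMod p)),
        finrank (ZMod p) W = K + 1 → (∀ x ∈ S, x ∈ W) →
        (∀ x ∈ W, ∀ a ∈ W, ∀ b ∈ W, p ∣ planeCount S x a b) →
        ∃ d ∈ perIn W S, d ≠ 0) := by
  constructor
  · intro h W S hK hSW hdiv
    exact exists_period_of_finrank_le (h W S hSW hdiv) (by omega)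
  · intro h W S hSW hdiv
    refine finrank_le_of_band K (fun W S hK _ hSW hdiv ih => ?_) W S hSW hdiv
    by_cases hdim : finrank (ZMod p) W = K + 1
    · exact h W S hdim hSW hdiv
    · exact exists_period_of_hyper hSW hdiv (by omega) ih

/-- HEADLINE at `K = 3`: if every plane-divisible set in every `4`-dimensional subspace of `𝔽_pⁿ` has a
nonzero period, then every plane-divisible `S ⊆ W ≤ 𝔽_pⁿ` is a cylinder over `≤ 3` coordinates of `W`
(the field core `K_field(p) ≤ 3` of the second structure law, inside `𝔽_pⁿ`). -/
theorem finrank_le_three_of_dim_four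
    (h4 : ∀ (W : Submodule (ZMod p) (Fin n → ZMod p)) (S : Finset (Fin n → ZMod p)),
        finrank (ZMod p) W = 4 → (∀ x ∈ S, x ∈ W) →
        (∀ x ∈ W, ∀ a ∈ W, ∀ b ∈ W, p ∣ planeCount S x a b) → ∃ d ∈ perIn W S, d ≠ 0)
    (W : Submodule (ZMod p) (Fin n → ZMod p)) (S : Finset (Fin n → ZMod p))
    (hSW : ∀ x ∈ S, x ∈ W) (hdiv : ∀ x ∈ W, ∀ a ∈ W, ∀ b ∈ W, p ∣ planeCount S x a b) :
    finrank (ZMod p) W ≤ finrank (ZMod p) (perIn W S) + 3 :=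
  (law_iff_succ 3).mpr h4 W S hSW hdiv

/-- Ambient form: under the dimension-`(K+1)` hypothesis for the subspaces of `𝔽_pⁿ`, every `S ⊆ 𝔽_pⁿ` all of
whose parametrised plane counts are divisible by `p` has a period space of dimension `≥ n - K`. -/
theorem finrank_perIn_top_ge_of_succ (K : ℕ)
    (h : ∀ (W : Submodule (ZMod p) (Fin n → ZMod p)) (S : Finset (Fin n → ZMod p)),
        finrank (ZMod p) W = K + 1 → (∀ x ∈ S, x ∈ W) →
        (∀ x ∈ W, ∀ a ∈ W, ∀ b ∈ W, p ∣ planeCount S x a b) → ∃ d ∈ perIn W S, d ≠ 0)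
    (S : Finset (Fin n → ZMod p)) (hdiv : ∀ x a b : Fin n → ZMod p, p ∣ planeCount S x a b) :
    n ≤ finrank (ZMod p) (perIn ⊤ S) + K := by
  have := (law_iff_succ K).mpr h ⊤ S (fun _ _ => Submodule.mem_top) (fun x _ a _ b _ => hdiv x a b)
  simpa using this

/-! ## Transport to the model space `𝔽_p^m` (the finite census instance is `𝔽₅⁴` itself) -/

/-- TRANSPORT.  If every `S' ⊆ 𝔽_p^m` with all parametrised plane counts divisible by `p` has a nonzero
period, then so does every plane-divisible `S` in every `m`-dimensional subspace `W ≤ 𝔽_pⁿ` (pull `S` back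
along a linear isomorphism `𝔽_p^m ≃ W`; plane counts and periods correspond). -/
theorem exists_period_of_top {m : ℕ}
    (h : ∀ S' : Finset (Fin m → ZMod p), (∀ x a b : Fin m → ZMod p, p ∣ planeCount S' x a b) →
      ∃ d ∈ perIn ⊤ S', d ≠ 0)
    (W : Submodule (ZMod p) (Fin n → ZMod p)) (S : Finset (Fin n → ZMod p))
    (hW : finrank (ZMod p) W = m) (hSW : ∀ x ∈ S, x ∈ W)
    (hdiv : ∀ x ∈ W, ∀ a ∈ W, ∀ b ∈ W, p ∣ planeCount S x a b) : ∃ d ∈ perIn W S, d ≠ 0 := by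
  classical
  let bW := Module.finBasisOfFinrankEq (ZMod p) W hW
  let e : W ≃ₗ[ZMod p] (Fin m → ZMod p) := bW.equivFun
  let ι : (Fin m → ZMod p) → (Fin n → ZMod p) := fun y => ((e.symm y : W) : Fin n → ZMod p)
  have hιW : ∀ y, ι y ∈ W := fun y => (e.symm y).2
  have hιadd : ∀ y z, ι (y + z) = ι y + ι z := fun y z => by simp [ι, map_add]
  have hιsmul : ∀ (c : ZMod p) (y), ι (c • y) = c • ι y := fun c y => by simp [ι, map_smul]
  have hιzero : ι 0 = 0 := by simp [ι]
  have hιinj : Function.Injective ι := by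
    intro y z hyz
    have : e.symm y = e.symm z := Subtype.ext hyz
    exact e.symm.injective this
  have hιsurj : ∀ x ∈ W, ∃ y, ι y = x := fun x hx => ⟨e ⟨x, hx⟩, by simp [ι]⟩
  let S' : Finset (Fin m → ZMod p) := Finset.univ.filter fun y => ι y ∈ S
  have hmemS' : ∀ y, y ∈ S' ↔ ι y ∈ S := fun y => by simp [S']
  have hpc : ∀ x a b, planeCount S' x a b = planeCount S (ι x) (ι a) (ι b) := by
    intro x a b
    unfold planeCount
    congr 1
    ext st
    simp only [mem_filter, mem_univ, true_and]
    rw [hmemS', hιadd, hιadd, hιsmul, hιsmul]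
  have hdiv' : ∀ x a b, p ∣ planeCount S' x a b := fun x a b => by
    rw [hpc]; exact hdiv _ (hιW x) _ (hιW a) _ (hιW b)
  obtain ⟨d', hd', hd'0⟩ := h S' hdiv'
  have hper' : ∀ y, y ∈ S' ↔ y + d' ∈ S' := (mem_perIn.mp hd').2
  refine ⟨ι d', mem_perIn.mpr ⟨hιW d', ?_⟩, ?_⟩
  · intro x
    by_cases hx : x ∈ W
    · obtain ⟨y, rfl⟩ := hιsurj x hx
      rw [← hιadd, ← hmemS', ← hmemS']
      exact hper' y
    · have h1 : x ∉ S := fun h' => hx (hSW x h')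
      have h2 : x + ι d' ∉ S := fun h' => hx (by
        have := W.sub_mem (hSW _ h') (hιW d')
        simpa using this)
      simp [h1, h2]
  · intro h0
    apply hd'0
    apply hιinj
    rw [h0, hιzero]

/-- ★★ THE FIELD CORE AT `K = 3`, CENSUS FORM.  If every `S' ⊆ 𝔽_p⁴` all of whose parametrised plane counts are
divisible by `p` has a nonzero period (at `p = 5`: census instance K44-general UNSAT), then every
plane-divisible `S ⊆ W ≤ 𝔽_pⁿ` is a cylinder over `≤ 3` coordinates of `W`, for EVERY `n`. -/
theorem finrank_le_three_of_top_four
    (h4 : ∀ S' : Finset (Fin 4 → ZMod p), (∀ x a b : Fin 4 → ZMod p, p ∣ planeCount S' x a b) →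
      ∃ d ∈ perIn ⊤ S', d ≠ 0)
    (W : Submodule (ZMod p) (Fin n → ZMod p)) (S : Finset (Fin n → ZMod p))
    (hSW : ∀ x ∈ S, x ∈ W) (hdiv : ∀ x ∈ W, ∀ a ∈ W, ∀ b ∈ W, p ∣ planeCount S x a b) :
    finrank (ZMod p) W ≤ finrank (ZMod p) (perIn W S) + 3 :=
  finrank_le_three_of_dim_four (fun W S hW hSW hdiv => exists_period_of_top h4 W S hW hSW hdiv)
    W S hSW hdiv

end Summit.QuantumAdvantage.AdviceFreeQNC0.PlaneDiv

namespace Summit.QuantumAdvantage.AdviceFreeQNC0.PlaneDiv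

open Finset Module

variable {p : ℕ} [Fact p.Prime]

/-- ★★ DIMENSION ELIMINATION, model-space form (one `p`, one `K`, ALL ambient dimensions): the codimension
law `K` for every plane-divisible set in every subspace of every `𝔽_pⁿ` ⟺ every `S' ⊆ 𝔽_p^{K+1}` with all
parametrised plane counts divisible by `p` has a nonzero period. -/
theorem law_iff_top (K : ℕ) :
    (∀ (n : ℕ) (W : Submodule (ZMod p) (Fin n → ZMod p)) (S : Finset (Fin n → ZMod p)),
        (∀ x ∈ S, x ∈ W) → (∀ x ∈ W, ∀ a ∈ W, ∀ b ∈ W, p ∣ planeCount S x a b) →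
        finrank (ZMod p) W ≤ finrank (ZMod p) (perIn W S) + K) ↔
    (∀ S' : Finset (Fin (K + 1) → ZMod p),
        (∀ x a b : Fin (K + 1) → ZMod p, p ∣ planeCount S' x a b) → ∃ d ∈ perIn ⊤ S', d ≠ 0) := by
  constructor
  · intro h S' hdiv
    have htop : finrank (ZMod p) (⊤ : Submodule (ZMod p) (Fin (K + 1) → ZMod p)) = K + 1 := by
      rw [finrank_top, Module.finrank_fin_fun]
    exact exists_period_of_finrank_le
      (h (K + 1) ⊤ S' (fun _ _ => Submodule.mem_top) (fun x _ a _ b _ => hdiv x a b)) (by omega)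
  · intro h n W S hSW hdiv
    exact (law_iff_succ K).mpr (fun W S hW hSW hdiv => exists_period_of_top h W S hW hSW hdiv)
      W S hSW hdiv

end Summit.QuantumAdvantage.AdviceFreeQNC0.PlaneDiv
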